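import Mathlib.NumberTheory.SiegelsLemma
import Mathlib.Analysis.SpecialFunctions.Pow.Real
import Mathlib.Algebra.Polynomial.BigOperators
import Literature.NumberTheory.Transcendental.ChudnovskyHeights
import HarnessLib

/-!
# Chudnovsky's theorem on periods — Siegel's lemma with coefficients in `ℤ[θ]`

Topic `Literature/NumberTheory/Transcendental` (trunk T-TRANSCEND). Node [SI] of the proof of
`Literature.NumberTheory.Transcendental.Chudnovsky1984_thm_7_3_1` (Chudnovsky 1984, Ch. 7, Theorem 3.1).

Chudnovsky 1984, Ch. 7, §2, p. 307 (variant (C)) and §3, p. 309: the auxiliary function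
`F(z) = P(ζ(z) - (η/ω)z, ℘(z))` has coefficients "polynomials from `ℤ[θ]`" chosen "using the
Siegel lemma" so that many derivatives vanish; the linear conditions have coefficients in
`ℤ[θ]` (after the regular representation of `ChudnovskyEnvelope.lean`, in `M_d(ℤ[T])`), and
`θ` being transcendental, an identity in `ℤ[T]` is the same as an identity in `ℤ[θ]`.
Expanding the unknown polynomials `p_λ(T) = ∑_{a<A} n_{λ,a} T^a` and equating coefficients of
powers of `T` turns the system `∑_λ p_λ(T) W_{e,λ}(T) = 0` (`e ∈ ι`) into an integer linear
system for the `n_{λ,a}` with `#ι · (A + δ)` equations and `#Λ · A` unknowns, to which Mathlib's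
Siegel lemma `Int.Matrix.exists_ne_zero_int_vec_norm_le` applies.

## Contents (no definitions)

* `siegel_poly` — if `deg W_{e,λ} ≤ δ`, `|coeff W_{e,λ}| ≤ B` and `#Λ · A ≥ 2 #ι (A + δ)`, there are
  `p_λ ∈ ℤ[T]`, not all zero, `deg p_λ < A`, `|coeff p_λ| ≤ #Λ · A · B`, with
  `∑_λ p_λ W_{e,λ} = 0` for all `e`.
-/

noncomputable section

open scoped Polynomial
open Finset

attribute [local instance] Matrix.seminormedAddCommGroup

namespace Literature.NumberTheory.Transcendental.Chudnovsky

/-- **Siegel's lemma for polynomial unknowns** (Chudnovsky 1984, Ch. 7, §2, p. 307: "using the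
Siegel lemma … `P(x, y) ∈ K[x, y]`"). Let `W_{e,λ} ∈ ℤ[T]` (`e ∈ ι`, `λ ∈ Λ`) have degrees `≤ δ`
and coefficients bounded by the real number `B ≥ 1` in absolute value, and let `A ≥ 1` with
`#Λ · A ≥ 2 · #ι · (A + δ)` (`#ι ≥ 1`). Then there are `p_λ ∈ ℤ[T]`, not all zero, of degree `< A`,
with all coefficients bounded by `#Λ · A · B`, such that `∑_λ p_λ W_{e,λ} = 0` for every `e`.
[cite: Chudnovsky1984, Ch. 7 §2 p. 307] -/
theorem siegel_poly {ι Λ : Type*} [Fintype ι] [Fintype Λ] [DecidableEq Λ]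
    (W : ι → Λ → ℤ[X]) (δ A : ℕ) (B : ℝ)
    (hδ : ∀ e l, (W e l).natDegree ≤ δ) (hB : ∀ e l k, |((W e l).coeff k : ℝ)| ≤ B) (hB1 : 1 ≤ B)
    (hι : 0 < Fintype.card ι) (hA : 0 < A)
    (hcard : 2 * (Fintype.card ι * (A + δ)) ≤ Fintype.card Λ * A) :
    ∃ p : Λ → ℤ[X], p ≠ 0 ∧ (∀ l, (p l).natDegree < A) ∧
      (∀ l k, |((p l).coeff k : ℝ)| ≤ Fintype.card Λ * A * B) ∧
      ∀ e, ∑ l, p l * W e l = 0 := by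
  classical
  -- the integer system
  let αT := ι × Fin (A + δ)
  let βT := Λ × Fin A
  let Amat : Matrix αT βT ℤ := Matrix.of fun es la =>
    if (la.2 : ℕ) ≤ es.2 then (W es.1 la.1).coeff (es.2 - la.2) else 0
  have hm : 0 < Fintype.card αT := by
    simp only [αT, Fintype.card_prod, Fintype.card_fin]
    exact Nat.mul_pos hι (by omega)
  have hmn : 2 * Fintype.card αT ≤ Fintype.card βT := by
    simpa [αT, βT, Fintype.card_prod, Fintype.card_fin] using hcard
  have hn : Fintype.card αT < Fintype.card βT := by omega
  obtain ⟨t, ht0, hAt, htnorm⟩ := Int.Matrix.exists_ne_zero_int_vec_norm_le Amat hn hm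
  -- the polynomials
  let p : Λ → ℤ[X] := fun l => ∑ a : Fin A, Polynomial.monomial (a : ℕ) (t (l, a))
  have hpcoeff : ∀ l k, (p l).coeff k = if h : k < A then t (l, ⟨k, h⟩) else 0 := fun l k =>
    coeff_sum_monomial_fin (fun a => t (l, a)) k
  have hpdeg : ∀ l, (p l).natDegree < A := by
    intro l
    by_cases h0 : p l = 0
    · rw [h0, Polynomial.natDegree_zero]; exact hA
    · rw [Polynomial.natDegree_lt_iff_degree_lt h0, Polynomial.degree_lt_iff_coeff_zero]
      intro k hk
      rw [hpcoeff, dif_neg (by omega)]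
  refine ⟨p, ?_, hpdeg, ?_, ?_⟩
  · -- `p ≠ 0`
    intro hp
    apply ht0
    funext ⟨l, a⟩
    have := congr_fun hp l
    have hc := congrArg (fun q : ℤ[X] => q.coeff a) this
    simp only [Pi.zero_apply, Polynomial.coeff_zero, hpcoeff, dif_pos a.2] at hc
    exact hc
  · -- the bound on the coefficients
    intro l k
    rw [hpcoeff]
    split_ifs with h
    · have hAnorm : ‖Amat‖ ≤ B := by
        rw [Matrix.norm_le_iff (by positivity)]
        rintro ⟨e, s⟩ ⟨l', a⟩
        simp only [Amat, Matrix.of_apply]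
        split_ifs
        · rw [Int.norm_eq_abs]
          exact hB e l' _
        · simp only [norm_zero]; linarith
      have hbase : 1 ≤ (Fintype.card βT : ℝ) * max 1 ‖Amat‖ := by
        have : (1 : ℝ) ≤ Fintype.card βT := by exact_mod_cast (show 1 ≤ Fintype.card βT by omega)
        nlinarith [le_max_left (1 : ℝ) ‖Amat‖]
      have hexp : ((Fintype.card αT : ℕ) : ℝ) / (Fintype.card βT - Fintype.card αT) ≤ 1 := by
        rw [div_le_one] <;>
        · have h1 : ((Fintype.card αT : ℕ) : ℝ) * 2 ≤ Fintype.card βT := by exact_mod_cast (by omega)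
          have h2 : (0 : ℝ) < Fintype.card αT := by exact_mod_cast hm
          linarith
      have htk : |(t (l, ⟨k, h⟩) : ℝ)| ≤ ‖t‖ := by
        have := norm_le_pi_norm t (l, ⟨k, h⟩)
        rwa [Int.norm_eq_abs] at this
      calc |(t (l, ⟨k, h⟩) : ℝ)| ≤ ‖t‖ := htk
        _ ≤ ((Fintype.card βT : ℝ) * max 1 ‖Amat‖) ^
              (((Fintype.card αT : ℕ) : ℝ) / (Fintype.card βT - Fintype.card αT)) := htnorm
        _ ≤ (Fintype.card βT : ℝ) * max 1 ‖Amat‖ := Real.rpow_le_self_of_one_le hbase hexp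
        _ ≤ (Fintype.card Λ * A : ℝ) * B := by
            have hβ : (Fintype.card βT : ℝ) = Fintype.card Λ * A := by
              simp [βT, Fintype.card_prod, Fintype.card_fin]
            rw [hβ]
            gcongr
            exact max_le hB1 hAnorm
        _ = Fintype.card Λ * A * B := by ring
    · simp only [Int.cast_zero, abs_zero]; positivity
  · -- the equations
    intro e
    -- coefficient `s` of `∑_l p_l W_{e,l}` is the `(e, s)` entry of `Amat *ᵥ t` for `s < A + δ`
    have hcoeff : ∀ s : Fin (A + δ), (∑ l, p l * W e l).coeff (s : ℕ) = (Amat.mulVec t) (e, s) := by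
      intro s
      rw [Polynomial.finsetSum_coeff, Matrix.mulVec, dotProduct, Fintype.sum_prod_type]
      refine Finset.sum_congr rfl fun l _ => ?_
      rw [Polynomial.coeff_mul, Finset.Nat.sum_antidiagonal_eq_sum_range_succ
        (fun i j => (p l).coeff i * (W e l).coeff j)]
      -- both sides: sum over `a < A`, `a ≤ s` of `coeff_a (p l) * coeff_{s-a} W`
      have hf0 : ∀ k, A ≤ k → (p l).coeff k * (W e l).coeff (s - k) = 0 := fun k hk => by
        rw [hpcoeff, dif_neg (by omega), zero_mul]
      rw [← Finset.sum_filter_of_ne (p := fun k => k < A) (fun k _ hne => by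
        by_contra hk
        exact hne (hf0 k (not_lt.mp hk)))]
      have hR : ∑ a : Fin A, Amat (e, s) (l, a) * t (l, a) =
          ∑ a ∈ (Finset.range A).filter (fun a => a ≤ (s : ℕ)),
            (p l).coeff a * (W e l).coeff (s - a) := by
        rw [Finset.sum_filter, ← Fin.sum_univ_eq_sum_range
          (fun a => if a ≤ (s : ℕ) then (p l).coeff a * (W e l).coeff (s - a) else 0)]
        refine Finset.sum_congr rfl fun a _ => ?_
        simp only [Amat, Matrix.of_apply, hpcoeff, dif_pos a.2]
        split_ifs <;> simp [mul_comm]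
      rw [hR]
      refine Finset.sum_congr ?_ fun _ _ => rfl
      ext k
      simp only [Finset.mem_filter, Finset.mem_range]
      omega
    have hdeg : (∑ l, p l * W e l).natDegree < A + δ := by
      have h1 : (∑ l, p l * W e l).natDegree ≤ (A - 1) + δ := by
        refine Polynomial.natDegree_sum_le_of_forall_le _ _ fun l _ => ?_
        refine (Polynomial.natDegree_mul_le).trans ?_
        have := hpdeg l
        have := hδ e l
        omega
      omega
    ext k
    rw [Polynomial.coeff_zero]
    by_cases hk : k < A + δ
    · rw [show k = ((⟨k, hk⟩ : Fin (A + δ)) : ℕ) from rfl, hcoeff, hAt]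
      rfl
    · exact Polynomial.coeff_eq_zero_of_natDegree_lt (by omega)

end Literature.NumberTheory.Transcendental.Chudnovsky

end
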